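import Summits.ResolutionOfSingularities.ResolutionOfSingularities.Theorems.FrobeniusLadderFInjectiveMacaulayficationB9PointFloorRowClass
import Summits.ResolutionOfSingularities.ResolutionOfSingularities.Theorems.FrobeniusLadderFInjectiveMacaulayficationF108ClassRowAnyField
import Mathlib.FieldTheory.IsAlgClosed.AlgebraicClosure
import HarnessLib

/-!
# GAP-2 «k ≠ k̄»: THE CENSUS BED B9 `z² + x⁹ + y⁹ + u⁹ + t⁹` (every characteristic `p ∤ 18`) — POINT-FLOOR ROW AND GERM OVER ANY FIELD OF CHARACTERISTIC p (any-field twins of ✓ `…B9PointFloorRowClass`)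
# (crux `FInjectiveMacaulayfication` stmt-ResolutionOfSingularities-15315, chain w45a; seat res-L1-w45a-stub-2 g12; res-L1-w45a-plan-1 GO 2026-08-29T02:44:48Z
# «the H_F class level over EVERY field of characteristic p … then thin any-field rows per census bed»)

[OURS · L1 W4.5a] Support file (`--supports stmt-ResolutionOfSingularities-15315 --as helper`); def-free, unconditional; replaces the role of NO printed item; NOT a statement
of the manuscript; AI-written (AI review is weaker than expert review). OURS counted 0; nothing of the crux is proved.

Every theorem of ✓ `…B9PointFloorRowClass` that carried `[IsAlgClosed k]` is re-proved here WITHOUT it, for EVERY field `k` of characteristic p: the callees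
`FHalfRowOfNewtonNondegenerate.*` / `F108ClassRow.*_of_convenient*` (k = k̄) are swapped for this seat's any-field twins `FHalfRowAnyField.*_of_geomWeaklyNondegenerate` /
`F108ClassRowAnyField.*_of_convenient_anyField*` (✓ `…FHalfRowOfWeaklyNondegenerateAnyField`, ✓ `…F108ClassRowAnyField`), whose one changed hypothesis — GEOMETRIC weak
non-degeneracy, i.e. weak non-degeneracy of `map (algebraMap k K) f` over an algebraically closed `K ⊇ k` — is supplied by the bed's field-general Specimen lemma
`weaklyNondegenerate_b9` at `K := AlgebraicClosure k` (`geom_weaklyNondegenerate`). The field-general lemmas of the original file (strict transforms, shift identity,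
convenience, input side LEGAL / NOT FULL) are imported, not restated. Proof texts are otherwise the originals byte-for-byte.
SCOPE (desk caveat, binding): the vertex is the `k`-RATIONAL origin; closed points with residue field a proper extension of `k` are not addressed (GAP-2).
[OURS · thin application of landed theorems] [cite: IshiiSingularities2018, Thm. 4.4.23; Fedder1983, Thm. 1.12; StacksProject, Tag 080A; GortzWedhorn2020, Prop. 13.91 (2), (13.19)]
-/

-- single-problem summit: the doubled namespace component is forced
set_option linter.dupNamespace false

noncomputable section

open AlgebraicGeometry CategoryTheory Literature.AlgebraicGeometry.Resolution TopologicalSpace IsLocalRing MvPolynomial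

namespace Summit.ResolutionOfSingularities.ResolutionOfSingularities.Theorems.FInjectiveMacaulayfication.B9PointFloorRowAnyField

open Summit.ResolutionOfSingularities.ResolutionOfSingularities.Theorems.FInjectiveMacaulayfication
open Literature.AlgebraicGeometry.Resolution.BoubakriGreuelMarkwig SliceableCentre FanCheckKit B9NewtonKFan CensusBedsWeaklyNondegenerate
open Literature.AlgebraicGeometry.Resolution.BoubakriGreuelMarkwig B9PointFloorRowClass

/-- **GEOMETRIC weak non-degeneracy of the (shifted) bed over ANY field of characteristic p**: the field-general lemma `weaklyNondegenerate_b9`, applied over `AlgebraicClosure k` to `map (algebraMap k _) f` (which is the same polynomial expression). [OURS · plumbing] -/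
theorem geom_weaklyNondegenerate (k : Type) [Field k] (h3 : (3 : k) ≠ 0) (f : MvPolynomial (Fin 5) k)
    (hf : f = X 4 ^ 2 + X 0 ^ 9 + X 1 ^ 9 + X 2 ^ 9 + X 3 ^ 9) :
    ∀ w : Fin 5 → ℝ, (∀ i, 0 < w i) →
      IsWeaklyNondegenerateAlong w ((map (algebraMap k (AlgebraicClosure k)) f : MvPolynomial (Fin 5) (AlgebraicClosure k)) :
        MvPowerSeries (Fin 5) (AlgebraicClosure k)) := by
  have h3' : (3 : AlgebraicClosure k) ≠ 0 := fun h =>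
    h3 ((algebraMap k (AlgebraicClosure k)).injective (by rw [map_ofNat, map_zero]; exact h))
  refine weaklyNondegenerate_b9 (AlgebraicClosure k) h3' _ ?_
  subst hf
  simp


/-- ANY-FIELD TWIN (GAP-2 «k ≠ k̄»; `[IsAlgClosed k]` dropped, geometric weak non-degeneracy via `AlgebraicClosure k`): ★ **`Bl_{𝔪·K} X_{B9}` IS `FullCl p` AT EVERY POINT**, for every prime `p` with `2, 3 ≠ 0` in `k` ANY field (class route). [OURS · certificate instance]
[cite: IshiiSingularities2018, Thm. 4.4.23 and Cor. 4.4.25] -/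
theorem affineBlowup_mK_fullCl_b9_anyField (p : ℕ) [Fact p.Prime] (k : Type) [Field k] [CharP k p] (h2 : (2 : k) ≠ 0) (h3 : (3 : k) ≠ 0)
    (f : MvPolynomial (Fin 5) k) (hf : f = X 4 ^ 2 + X 0 ^ 9 + X 1 ^ 9 + X 2 ^ 9 + X 3 ^ 9) :
    ∀ y : ↥(affineBlowup (Ideal.span ((fun e : Fin 5 →₀ ℕ => Ideal.Quotient.mk (Ideal.span {f}) (monomial e (1 : k))) '' (genSet 5 AL2 : Set (Fin 5 →₀ ℕ))))),
      FullCl p ((affineBlowup (Ideal.span ((fun e : Fin 5 →₀ ℕ => Ideal.Quotient.mk (Ideal.span {f}) (monomial e (1 : k))) '' (genSet 5 AL2 : Set (Fin 5 →₀ ℕ))))).presheaf.stalk y) := by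
  classical
  choose g hθ hg0 using exists_refining_strictTransform k f hf
  exact FHalfRowAnyField.affineBlowup_fullCl_of_geomWeaklyNondegenerate p k (AlgebraicClosure k) f (B9Specimen.prime_f k h3 f hf)
    (geom_weaklyNondegenerate k h3 f hf) (B9Specimen.mk_X_ne_zero k h3 f hf)
    (fun x hx => B9Specimen.regular_off_vertex k h2 h3 f hf x.asIdeal hx)
    (genSet 5 AL2) hprimAJ.2.1 hprimAJ.1 25 (chartM 5 AL2 CL 25) (hcov k) Vq hV (chartA 5 AL2 CL 25) haA hgen hge g _ hθ hg0 (B9NewtonKFan.hv k _)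

/-- ANY-FIELD TWIN (GAP-2 «k ≠ k̄»; `[IsAlgClosed k]` dropped, geometric weak non-degeneracy via `AlgebraicClosure k`): ★★★ **THE B9 POINT FLOOR IS CURED — BY THE CLASS THEOREM, FOR EVERY PRIME `p` WITH `2, 3 ≠ 0` IN `k` ANY field.** See the module docstring. [OURS · certificate instance]
[cite: IshiiSingularities2018, Thm. 4.4.23 and Cor. 4.4.25] [cite: StacksProject, Tag 080A] -/
theorem pointFloor_b9_row_anyField (p : ℕ) [Fact p.Prime] (k : Type) [Field k] [CharP k p] (h2 : (2 : k) ≠ 0) (h3 : (3 : k) ≠ 0)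
    (f : MvPolynomial (Fin 5) k) (hf : f = X 4 ^ 2 + X 0 ^ 9 + X 1 ^ 9 + X 2 ^ 9 + X 3 ^ 9)
    (v : Spec (.of (MvPolynomial (Fin 5) k ⧸ Ideal.span {f})))
    (hv : v.asIdeal = Ideal.span (Set.range (fun j : Fin 5 => Ideal.Quotient.mk (Ideal.span {f}) (X j)))) :
    ∀ (S' : Scheme.{0}) (g : S' ⟶ Spec ((Spec (.of (MvPolynomial (Fin 5) k ⧸ Ideal.span {f}))).presheaf.stalk v)),
      IsBlowup g ((affineBlowup.idealSheaf (Ideal.span (Set.range (fun j : Fin 5 => Ideal.Quotient.mk (Ideal.span {f}) (X j))))).comap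
        ((Spec (.of (MvPolynomial (Fin 5) k ⧸ Ideal.span {f}))).fromSpecStalk v)) →
      ∃ 𝓚 : S'.IdealSheafData, 𝓚 ≠ ⊥ ∧
        (∀ s ∈ (𝓚.support : Set S'), g.base s = closedPoint ((Spec (.of (MvPolynomial (Fin 5) k ⧸ Ideal.span {f}))).presheaf.stalk v)) ∧
        ∀ (S'' : Scheme.{0}) (π : S'' ⟶ S'), IsBlowup π 𝓚 → ∀ s : S'', FullCl p (S''.presheaf.stalk s) := by
  classical
  choose g hθ hg0 using exists_refining_strictTransform k f hf
  exact FHalfRowAnyField.fHalfRow_of_geomWeaklyNondegenerate p k (AlgebraicClosure k) (by norm_num) f (B9Specimen.prime_f k h3 f hf)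
    (geom_weaklyNondegenerate k h3 f hf) (B9Specimen.mk_X_ne_zero k h3 f hf)
    (fun x hx => B9Specimen.regular_off_vertex k h2 h3 f hf x.asIdeal hx)
    (genSet 5 AL2) (genSet 5 KL2) (span_A_eq_floor_mul_K k _).1 hKprim.1 hprimAJ.2.1 hprimAJ.1 25 (chartM 5 AL2 CL 25) (hcov k) Vq hV
    (chartA 5 AL2 CL 25) haA hgen hge g _ hθ hg0 (B9NewtonKFan.hv k _) v hv

/-- ANY-FIELD TWIN (GAP-2 «k ≠ k̄»; `[IsAlgClosed k]` dropped, geometric weak non-degeneracy via `AlgebraicClosure k`): ★★★ **ROW B9, p-UNIFORM (hypotheses `2 ≠ 0`, `3 ≠ 0` in `k` ANY field of characteristic `p`): LEGAL ∧ NOT F(4)-iso (p) ∧ CURED.** The first two conjuncts are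
res-L1-w45a-stub-1 g13's `B9PointFloorNotFull` (input side, p-uniform Fedder certificate), the third is §3. [OURS · assembly of landed theorems] -/
theorem f4pos_rowB9_of_ne_anyField (p : ℕ) [Fact p.Prime] (k : Type) [Field k] [CharP k p] (h2 : (2 : k) ≠ 0) (h3 : (3 : k) ≠ 0)
    (f : MvPolynomial (Fin 5) k) (hf : f = X 4 ^ 2 + X 0 ^ 9 + X 1 ^ 9 + X 2 ^ 9 + X 3 ^ 9)
    (v : Spec (.of (MvPolynomial (Fin 5) k ⧸ Ideal.span {f})))
    (hv : v.asIdeal = Ideal.span (Set.range (fun j : Fin 5 => Ideal.Quotient.mk (Ideal.span {f}) (X j))))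
    (S' : Scheme.{0}) (g : S' ⟶ Spec ((Spec (.of (MvPolynomial (Fin 5) k ⧸ Ideal.span {f}))).presheaf.stalk v))
    (hg : IsBlowup g ((affineBlowup.idealSheaf (Ideal.span (Set.range (fun j : Fin 5 => Ideal.Quotient.mk (Ideal.span {f}) (X j))))).comap
      ((Spec (.of (MvPolynomial (Fin 5) k ⧸ Ideal.span {f}))).fromSpecStalk v))) :
    (((affineBlowup.idealSheaf (Ideal.span (Set.range (fun j : Fin 5 => Ideal.Quotient.mk (Ideal.span {f}) (X j))))).comap
        ((Spec (.of (MvPolynomial (Fin 5) k ⧸ Ideal.span {f}))).fromSpecStalk v)) ≠ ⊥ ∧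
      (((((affineBlowup.idealSheaf (Ideal.span (Set.range (fun j : Fin 5 => Ideal.Quotient.mk (Ideal.span {f}) (X j))))).comap
        ((Spec (.of (MvPolynomial (Fin 5) k ⧸ Ideal.span {f}))).fromSpecStalk v))).support :
          Set (Spec ((Spec (.of (MvPolynomial (Fin 5) k ⧸ Ideal.span {f}))).presheaf.stalk v))) ⊆
        (Scheme.regularLocus (Spec ((Spec (.of (MvPolynomial (Fin 5) k ⧸ Ideal.span {f}))).presheaf.stalk v)))ᶜ) ∧
      (∀ s : S', g.base s ≠ closedPoint ((Spec (.of (MvPolynomial (Fin 5) k ⧸ Ideal.span {f}))).presheaf.stalk v) → s ∈ Scheme.regularLocus S') ∧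
      (∀ s : S', CMCl (S'.presheaf.stalk s))) ∧
    (∃ s : S', g.base s = closedPoint ((Spec (.of (MvPolynomial (Fin 5) k ⧸ Ideal.span {f}))).presheaf.stalk v) ∧ ¬ FullCl p (S'.presheaf.stalk s)) ∧
    (∃ 𝓚 : S'.IdealSheafData, 𝓚 ≠ ⊥ ∧
      (∀ s ∈ (𝓚.support : Set S'), g.base s = closedPoint ((Spec (.of (MvPolynomial (Fin 5) k ⧸ Ideal.span {f}))).presheaf.stalk v)) ∧
      ∀ (S'' : Scheme.{0}) (π : S'' ⟶ S'), IsBlowup π 𝓚 → ∀ s : S'', FullCl p (S''.presheaf.stalk s)) :=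
  ⟨B9PointFloorNotFull.pointFloor_b9_input_legal k h2 h3 f hf v hv S' g hg, B9PointFloorNotFull.pointFloor_b9_not_full k p h3 f hf v hv S' g hg,
    pointFloor_b9_row_anyField p k h2 h3 f hf v hv S' g hg⟩

/-- ANY-FIELD TWIN (GAP-2 «k ≠ k̄»; `[IsAlgClosed k]` dropped, geometric weak non-degeneracy via `AlgebraicClosure k`): ★★★ **ROW B9 IN THE CENSUS LETTER: `f4pos_rowB9_anyField (p) (hp : p ∤ 18)`** — for EVERY prime `p ∤ 18` and `k` ANY field of characteristic `p`: for every blowing up `g : S′ → Spec 𝒪_{X,v}`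
along the point floor, LEGAL ∧ NOT `FullCl p` somewhere over the closed point ∧ CURED by some `𝓚 ≠ ⊥` over the closed point all of whose blowings up are `FullCl p` everywhere —
the first two-sided row of the F-half census not tied to `p ∈ {2, 3}`. [OURS · assembly of landed theorems] -/
theorem f4pos_rowB9_anyField (p : ℕ) [Fact p.Prime] (hp : ¬ p ∣ 18) (k : Type) [Field k] [CharP k p]
    (f : MvPolynomial (Fin 5) k) (hf : f = X 4 ^ 2 + X 0 ^ 9 + X 1 ^ 9 + X 2 ^ 9 + X 3 ^ 9)
    (v : Spec (.of (MvPolynomial (Fin 5) k ⧸ Ideal.span {f})))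
    (hv : v.asIdeal = Ideal.span (Set.range (fun j : Fin 5 => Ideal.Quotient.mk (Ideal.span {f}) (X j))))
    (S' : Scheme.{0}) (g : S' ⟶ Spec ((Spec (.of (MvPolynomial (Fin 5) k ⧸ Ideal.span {f}))).presheaf.stalk v))
    (hg : IsBlowup g ((affineBlowup.idealSheaf (Ideal.span (Set.range (fun j : Fin 5 => Ideal.Quotient.mk (Ideal.span {f}) (X j))))).comap
      ((Spec (.of (MvPolynomial (Fin 5) k ⧸ Ideal.span {f}))).fromSpecStalk v))) :
    (((affineBlowup.idealSheaf (Ideal.span (Set.range (fun j : Fin 5 => Ideal.Quotient.mk (Ideal.span {f}) (X j))))).comap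
        ((Spec (.of (MvPolynomial (Fin 5) k ⧸ Ideal.span {f}))).fromSpecStalk v)) ≠ ⊥ ∧
      (((((affineBlowup.idealSheaf (Ideal.span (Set.range (fun j : Fin 5 => Ideal.Quotient.mk (Ideal.span {f}) (X j))))).comap
        ((Spec (.of (MvPolynomial (Fin 5) k ⧸ Ideal.span {f}))).fromSpecStalk v))).support :
          Set (Spec ((Spec (.of (MvPolynomial (Fin 5) k ⧸ Ideal.span {f}))).presheaf.stalk v))) ⊆
        (Scheme.regularLocus (Spec ((Spec (.of (MvPolynomial (Fin 5) k ⧸ Ideal.span {f}))).presheaf.stalk v)))ᶜ) ∧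
      (∀ s : S', g.base s ≠ closedPoint ((Spec (.of (MvPolynomial (Fin 5) k ⧸ Ideal.span {f}))).presheaf.stalk v) → s ∈ Scheme.regularLocus S') ∧
      (∀ s : S', CMCl (S'.presheaf.stalk s))) ∧
    (∃ s : S', g.base s = closedPoint ((Spec (.of (MvPolynomial (Fin 5) k ⧸ Ideal.span {f}))).presheaf.stalk v) ∧ ¬ FullCl p (S'.presheaf.stalk s)) ∧
    (∃ 𝓚 : S'.IdealSheafData, 𝓚 ≠ ⊥ ∧
      (∀ s ∈ (𝓚.support : Set S'), g.base s = closedPoint ((Spec (.of (MvPolynomial (Fin 5) k ⧸ Ideal.span {f}))).presheaf.stalk v)) ∧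
      ∀ (S'' : Scheme.{0}) (π : S'' ⟶ S'), IsBlowup π 𝓚 → ∀ s : S'', FullCl p (S''.presheaf.stalk s)) :=
  f4pos_rowB9_of_ne_anyField p k (two_three_ne_zero p k hp).1 (two_three_ne_zero p k hp).2 f hf v hv S' g hg

/-- ANY-FIELD TWIN (GAP-2 «k ≠ k̄»; `[IsAlgClosed k]` dropped, geometric weak non-degeneracy via `AlgebraicClosure k`): ★ **THE GERM TWIN `b9_fInjectivizationGermAt_anyField`**: `FInjectivizationGermAt p v` for every prime `p` with `2, 3 ≠ 0` in `k` ANY field — the F-half's ∃-conclusion at the germ of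
`X_{B9}` at its vertex, witnessed by `(𝔪·K)·𝒪_{X,v}` (all of whose blowings up are `FullCl p` everywhere by §2; `𝔪·K ≠ ⊥` and `𝔪 ⊆ √(𝔪·K)` from the pure powers in `A`).
[OURS · certificate instance; cite: GortzWedhorn2020, Prop. 13.91 (2)] -/
theorem b9_fInjectivizationGermAt_anyField (p : ℕ) [Fact p.Prime] (k : Type) [Field k] [CharP k p] (h2 : (2 : k) ≠ 0) (h3 : (3 : k) ≠ 0)
    (f : MvPolynomial (Fin 5) k) (hf : f = X 4 ^ 2 + X 0 ^ 9 + X 1 ^ 9 + X 2 ^ 9 + X 3 ^ 9)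
    (v : Spec (.of (MvPolynomial (Fin 5) k ⧸ Ideal.span {f})))
    (hv : v.asIdeal = Ideal.span (Set.range (fun j : Fin 5 => Ideal.Quotient.mk (Ideal.span {f}) (X j)))) :
    GermForm.FInjectivizationGermAt p v := by
  classical
  have hprime := B9Specimen.prime_f k h3 f hf
  haveI hp : (Ideal.span {f}).IsPrime := (Ideal.span_singleton_prime hprime.ne_zero).mpr hprime
  haveI : IsDomain (MvPolynomial (Fin 5) k ⧸ Ideal.span {f}) := Ideal.Quotient.isDomain _
  refine GermOfGlobalBlowup.fInjectivizationGermAt_of_affineBlowup p _ ?_ v ?_ (affineBlowup_mK_fullCl_b9_anyField p k h2 h3 f hf)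
  · obtain ⟨N, hN⟩ := hprimAJ.2.1 0 (Finset.mem_univ _)
    intro h0
    have hmem : Ideal.Quotient.mk (Ideal.span {f}) (monomial (Finsupp.single 0 N) (1 : k)) ∈
        Ideal.span ((fun e : Fin 5 →₀ ℕ => Ideal.Quotient.mk (Ideal.span {f}) (monomial e (1 : k))) '' (genSet 5 AL2 : Set (Fin 5 →₀ ℕ))) :=
      Ideal.subset_span ⟨_, Finset.mem_coe.mpr hN, rfl⟩
    rw [h0, Ideal.mem_bot, ← X_pow_eq_monomial, map_pow] at hmem
    exact pow_ne_zero N (B9Specimen.mk_X_ne_zero k h3 f hf 0) hmem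
  · rw [hv, Ideal.span_le]
    rintro _ ⟨j, rfl⟩
    obtain ⟨N, hN⟩ := hprimAJ.2.1 j (Finset.mem_univ _)
    exact ⟨N, by rw [← map_pow, X_pow_eq_monomial]; exact Ideal.subset_span ⟨_, Finset.mem_coe.mpr hN, rfl⟩⟩

/-- ANY-FIELD TWIN (GAP-2 «k ≠ k̄»; `[IsAlgClosed k]` dropped, geometric weak non-degeneracy via `AlgebraicClosure k`): The germ twin in the census letter `p ∤ 18`. [OURS · corollary] -/
theorem b9_fInjectivizationGermAt_of_not_dvd_anyField (p : ℕ) [Fact p.Prime] (hp : ¬ p ∣ 18) (k : Type) [Field k] [CharP k p]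
    (f : MvPolynomial (Fin 5) k) (hf : f = X 4 ^ 2 + X 0 ^ 9 + X 1 ^ 9 + X 2 ^ 9 + X 3 ^ 9)
    (v : Spec (.of (MvPolynomial (Fin 5) k ⧸ Ideal.span {f})))
    (hv : v.asIdeal = Ideal.span (Set.range (fun j : Fin 5 => Ideal.Quotient.mk (Ideal.span {f}) (X j)))) :
    GermForm.FInjectivizationGermAt p v :=
  b9_fInjectivizationGermAt_anyField p k (two_three_ne_zero p k hp).1 (two_three_ne_zero p k hp).2 f hf v hv

end Summit.ResolutionOfSingularities.ResolutionOfSingularities.Theorems.FInjectiveMacaulayfication.B9PointFloorRowAnyField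

end
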